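import Summits.ResolutionOfSingularities.ResolutionOfSingularities.Theorems.FrobeniusGain
import HarnessLib

/-!
# PPowerFormLucas — decomp-res node «FrobeniusForm» (lens-4 g23, critic row 144), tree file 2/4 of the node

Content VERBATIM from the decomp-res lens-4 g23 file `HOME/decomp-res-lens-4/g23/FrobeniusForm.lean` (sha256
24d32aa2…, 1018 l; HOME = run/shared/lean/pub/decomp-res).
Critic: CRITIC-LEDGER row 144 (CLEARED 2026-08-30T20:58:02Z; MAP node: the two-way census dictionary «initial form
a `p`-power form ⟺ absolutely contact-free»
as a KERNEL theorem).  Split by the lens's sections for the 400-line limit (the critic's `PPowerForm` = §55–§57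
is two files here).  Landed by decomp-res writer g7
in the lens's namespace `…Theorems.HugValuationCut`.  Asides: NONE new — 28338
`LCNoWildContactFreeOffLocusTowers` stays the booked residual; `NoWildPPowerOffLocusTowers`
lands as a def with its up-link, to supersede 28338 only when an every-field iff makes the re-location exact (critic).

§55 (l. 204–512) THE LUCAS BITE MADE INTRINSIC and the two coordinate criteria (`mem_pPowerSpan_of_coeff`,
`exists_hasse_apply_of_coeff`, …).
PROVED, 0 sorry.  Imports `FrobeniusGain`.

[WRITER NOTE (decomp-res writer g7): file split only; namespace, section variables and every declaration exactly as
in the lens (global `set_option` dropped).  The lens's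
first import `MaxContactCutTameCut` (in the Theses cone, unused by any proof here) is replaced by the cone-free
`TameCutKernels` + `AbsoluteContactAxes` and the then-dangling
`open …Theses` dropped, so the whole node is OUTSIDE the Theses cone and importable by the route file when a later
every-field iff re-locates 28338.]

(Sources: Abad2019 Thm 4.11 / Prop 6.3; Giraud1975; CossartJannsenSaito2020; CossartPiltant2019 Prop. 2.50;
KawanoueMatsuki2016 §0.4.2; EGA IV₄ 16.11.2; Stacks 00TV.)
-/

noncomputable section

open CategoryTheory AlgebraicGeometry IsLocalRing
open Literature.AlgebraicGeometry.Resolution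
open Summit.ResolutionOfSingularities.ResolutionOfSingularities.Theorems
open WeakOrderReduction ForcedTowerClasses DivergentTowerClasses MonomialTowerClasses
open HugDimensionClasses HugDimensionKernels SurfaceShadowClasses SurfaceShadowKernels
open NearPointCut (SingularClass)
open AbsoluteContactClasses (IsAbsContactAt SepResidueAt diffIdeal_restrict_le stalkMap_comp_toStalk_eq_stalkHom)
open scoped BigOperators

namespace Summit.ResolutionOfSingularities.ResolutionOfSingularities.Theorems.HugValuationCut

/-! ## §55 (g23 · NEW · KERNEL, pure algebra, hypothesis-free) THE LUCAS BITE MADE INTRINSIC and THE TWO COORDINATE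
READINGS of a presentation `f = Σ_{|β| = N+1} c_β u^β` along generators `u` of `𝔪`:
unit coefficient with an exponent `≢ 0 (mod p)` ⟹ `Δ_q f ∈ 𝔪 ∖ 𝔪²` for some `|q| = N`;
every unit-coefficient monomial a `p`-th power ⟹ `f ∈ ⟨h^p : h ∈ 𝔪^{(N+1)/p}⟩ + 𝔪^{N+2}`. -/

section LucasBite

variable {k R : Type*} [CommRing k] [CommRing R] [Algebra k R]

/-- An operator of order `≤ 1` is `R`-linear modulo any ideal containing its argument:
`D (c x) − c D x = [D,c](1) · x ∈ J` for `x ∈ J`. (Sources: EGAIV4, Prop. 16.8.8.) -/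
theorem sub_mem_of_isDiffOpLE_one {D : R →ₗ[k] R} (hD : IsDiffOpLE k 1 D) (c : R) {J : Ideal R} {x : R}
    (hx : x ∈ J) : D (c * x) - c * D x ∈ J := by
  have h := LinearMap.congr_fun (isDiffOpLE_zero_iff_eq_mulLeft.mp (hD c)) x
  rw [LinearMap.mulLeft_apply, commMul_apply] at h
  rw [h]
  exact J.mul_mem_left _ hx

variable {ι : Type*} [Fintype ι]

/-- monomials of degree `|β|` in elements of `M` lie in `M^{|β|}`. [folklore] -/
theorem prod_pow_mem_pow_degree {u : ι → R} {M : Ideal R} (hum : ∀ i, u i ∈ M) (β : ι →₀ ℕ) :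
    (∏ i, u i ^ β i) ∈ M ^ β.degree := by
  rw [Finsupp.degree_eq_sum, ← Finset.prod_pow_eq_pow_sum]
  exact Ideal.prod_mem_prod fun i _ => Ideal.pow_mem_pow (hum i) _

/-- a presentation by a homogeneous polynomial of degree `N + 1` in elements of `M` lies in `M^{N+1}`. [folklore] -/
theorem eval_mem_pow_of_isHomogeneous {u : ι → R} {M : Ideal R} (hum : ∀ i, u i ∈ M) {N : ℕ}
    (P : MvPolynomial ι R) (hP : P.IsHomogeneous (N + 1)) : MvPolynomial.eval u P ∈ M ^ (N + 1) := by
  classical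
  rw [MvPolynomial.eval_eq']
  refine Ideal.sum_mem _ fun d hd => Ideal.mul_mem_left _ _ ?_
  have hdeg : Finsupp.degree d = N + 1 := by
    rw [Finsupp.degree_eq_weight_one]; exact hP (MvPolynomial.mem_support_iff.mp hd)
  exact hdeg ▸ prod_pow_mem_pow_degree hum d

/-- **COORDINATE READING, `p`-POWER SIDE (KERNEL, PROVED)**: if every monomial of the presentation with a coefficient
outside `𝔪` has all exponents divisible by `p`, then `f ∈ ⟨h^p : h ∈ 𝔪^{(N+1)/p}⟩ + 𝔪^{N+2}` (`c
u^{p β'} = c (u^{β'})^p`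
with `u^{β'} ∈ 𝔪^{|β'|}`, `p |β'| = N + 1`). (Sources: Giraud1975; CossartPiltant2008, Prop. 4.2.) -/
theorem mem_pPowerSpan_of_coeff {u : ι → R} {M : Ideal R} (hum : ∀ i, u i ∈ M) {N : ℕ} {p : ℕ} (hp : p.Prime)
    (P : MvPolynomial ι R) (hP : P.IsHomogeneous (N + 1))
    (hcoeff : ∀ d ∈ P.support, P.coeff d ∈ M ∨ ∀ i, p ∣ d i) :
    MvPolynomial.eval u P ∈ Ideal.span ((fun h : R => h ^ p) '' ↑(M ^ ((N + 1) / p))) ⊔ M ^ (N + 2) := by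
  classical
  have hmon : ∀ β : ι →₀ ℕ, (∏ i, u i ^ β i) ∈ M ^ β.degree := fun β => prod_pow_mem_pow_degree hum β
  have hdeg : ∀ d ∈ P.support, Finsupp.degree d = N + 1 := fun d hd => by
    rw [Finsupp.degree_eq_weight_one]; exact hP (MvPolynomial.mem_support_iff.mp hd)
  rw [MvPolynomial.eval_eq']
  refine Ideal.sum_mem _ fun d hd => ?_
  rcases hcoeff d hd with hc | hdiv
  · refine Ideal.mem_sup_right ?_
    have : P.coeff d * ∏ i, u i ^ d i ∈ M * M ^ (N + 1) := Ideal.mul_mem_mul hc (hdeg d hd ▸ hmon d)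
    rwa [← pow_succ'] at this
  · refine Ideal.mem_sup_left (Ideal.mul_mem_left _ _ ?_)
    -- `d = p · d'`
    let d' : ι →₀ ℕ := Finsupp.mapRange (fun n => n / p) (Nat.zero_div p) d
    have hd' : ∀ i, d i = p * d' i := fun i => by
      rw [Finsupp.mapRange_apply]; exact (Nat.mul_div_cancel' (hdiv i)).symm
    have hprod : (∏ i, u i ^ d i) = (∏ i, u i ^ d' i) ^ p := by
      rw [← Finset.prod_pow]
      exact Finset.prod_congr rfl fun i _ => by rw [hd' i, pow_mul, ← pow_mul, ← pow_mul, mul_comm]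
    have hsum : p * d'.degree = N + 1 := by
      rw [← hdeg d hd, Finsupp.degree_eq_sum, Finsupp.degree_eq_sum, Finset.mul_sum]
      exact Finset.sum_congr rfl fun i _ => (hd' i).symm
    have hd'deg : d'.degree = (N + 1) / p := by
      rw [← hsum, Nat.mul_div_cancel_left _ hp.pos]
    rw [hprod]
    exact Ideal.subset_span ⟨_, by simpa [hd'deg] using hmon d', rfl⟩

variable [IsLocalRing R] [DecidableEq ι]

/-- **COORDINATE READING, CONTACT SIDE = THE LUCAS BITE (KERNEL, PROVED).**  `R` local, `u : ι → R` generators of `𝔪`,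
`Δ` a truncated Hasse–Schmidt system of level `N + 1` along `u` (`Δ_0 = id`, higher Leibniz rule,
`Δ_q(u^β) = (β over q) u^{β−q}`, `Δ_q ∈ Diff^{≤ d}` for `|q| ≤ d`), every integer prime to `p` a unit of `R`;
`f = P(u)` with `P` homogeneous of degree `N + 1` having a monomial `u^β` with coefficient OUTSIDE `𝔪` and an exponent
`β_i ≢ 0 (mod p)`.  Then `Δ_{β − e_i} f ∈ 𝔪 ∖ 𝔪²` (`Δ_{e_i} Δ_{β−e_i} f ≡ β_i · c_β (mod
𝔪)` is a unit while
`Δ_{e_i}(𝔪²) ⊆ 𝔪`).  No residue-field hypothesis, no coefficient field, no (UNR).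
(Sources: EGAIV4, Thm. 16.11.2; Giraud1975; EncinasVillamayor2000, Thm. 4.9; Kawanoue2007, Ch. 4.) -/
theorem exists_hasse_apply_of_coeff {u : ι → R} (hu : Ideal.span (Set.range u) = maximalIdeal R) {N : ℕ}
    {Δ : (ι →₀ ℕ) → (R →ₗ[k] R)} (h0 : ∀ b, Δ 0 b = b)
    (hL : ∀ q : ι →₀ ℕ, q.degree ≤ N + 1 →
      ∀ f g : R, Δ q (f * g) = ∑ c ∈ Finset.HasAntidiagonal.antidiagonal q, Δ c.1 f * Δ c.2 g)
    (hV : ∀ q β : ι →₀ ℕ, q.degree ≤ N + 1 →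
      Δ q (∏ i, u i ^ β i) = ((∏ i ∈ q.support, (β i).choose (q i) : ℕ) : R) * ∏ i, u i ^ (β - q) i)
    (hD : ∀ (d : ℕ) (q : ι →₀ ℕ), q.degree ≤ d → d ≤ N + 1 → IsDiffOpLE k d (Δ q))
    {p : ℕ} (hunit : ∀ m : ℕ, ¬ p ∣ m → IsUnit ((m : ℕ) : R)) {f : R}
    (P : MvPolynomial ι R) (hP : P.IsHomogeneous (N + 1)) (hPf : MvPolynomial.eval u P = f)
    {β₀ : ι →₀ ℕ} (hβ₀ : β₀ ∈ P.support) (hc : P.coeff β₀ ∉ maximalIdeal R) {i : ι} (hi : ¬ p ∣ β₀ i) :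
    ∃ q : ι →₀ ℕ, q.degree = N ∧ Δ q f ∈ maximalIdeal R ∧ Δ q f ∉ maximalIdeal R ^ 2 := by
  classical
  have hum : ∀ i, u i ∈ maximalIdeal R := fun i => hu ▸ Ideal.subset_span ⟨i, rfl⟩
  have hmon : ∀ β : ι →₀ ℕ, (∏ i, u i ^ β i) ∈ maximalIdeal R ^ β.degree := fun β => prod_pow_mem_pow_degree hum β
  have hdeg : ∀ d ∈ P.support, Finsupp.degree d = N + 1 := fun d hd => by
    have := hP (MvPolynomial.mem_support_iff.mp hd)
    rw [Finsupp.degree_eq_weight_one]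
    exact this
  have hf : f = ∑ d ∈ P.support, P.coeff d * ∏ i, u i ^ d i := by rw [← hPf, MvPolynomial.eval_eq']
  have h1 : f ∈ maximalIdeal R ^ (N + 1) := hPf ▸ eval_mem_pow_of_isHomogeneous hum P hP
  have hβdeg : β₀.degree = N + 1 := hdeg β₀ hβ₀
  -- `e = e_i`, `q = β₀ − e_i`
  set e : ι →₀ ℕ := Finsupp.single i 1 with he
  have heβ : e ≤ β₀ := by
    rw [he, Finsupp.single_le_iff]
    exact Nat.one_le_iff_ne_zero.mpr fun h => hi (h ▸ dvd_zero p)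
  have hedeg : e.degree = 1 := by rw [he, Finsupp.degree_single]
  set q : ι →₀ ℕ := β₀ - e with hq
  have hqe : q + e = β₀ := tsub_add_cancel_of_le heβ
  have hβq : β₀ - q = e := by rw [← hqe, add_tsub_cancel_left]
  have hqdeg : q.degree = N := by
    have := congrArg Finsupp.degree hqe
    rw [map_add, hedeg, hβdeg] at this
    omega
  have hβi : β₀ i = q i + 1 := by rw [← hqe, Finsupp.add_apply, he, Finsupp.single_eq_same]
  have hβj : ∀ j, j ≠ i → β₀ j = q j := fun j hj => by
    rw [← hqe, Finsupp.add_apply, he, Finsupp.single_apply, if_neg fun h => hj h.symm, add_zero]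
  have hΔq : IsDiffOpLE k N (Δ q) := hD N q hqdeg.le (Nat.le_succ N)
  have hΔe : IsDiffOpLE k 1 (Δ e) := hD 1 e hedeg.le (by omega)
  -- `Δ_q f ∈ 𝔪`
  have hm1 : Δ q f ∈ maximalIdeal R := by
    have := hΔq.apply_mem_pow_sub (maximalIdeal R) (N + 1) h1
    rwa [Nat.add_sub_cancel_left, pow_one] at this
  refine ⟨q, hqdeg, hm1, fun hm2 => ?_⟩
  -- `Δ_e Δ_q f ∈ 𝔪` if `Δ_q f ∈ 𝔪²`
  have hy : Δ e (Δ q f) ∈ maximalIdeal R := by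
    have := hΔe.apply_mem_pow_sub (maximalIdeal R) 2 hm2
    rwa [show 2 - 1 = 1 from rfl, pow_one] at this
  -- the expansion of `Δ_e Δ_q f`
  have hexp : Δ e (Δ q f) = ∑ d ∈ P.support, ∑ ab ∈ Finset.HasAntidiagonal.antidiagonal q,
      Δ e (Δ ab.1 (P.coeff d) * Δ ab.2 (∏ j, u j ^ d j)) := by
    rw [hf, map_sum, map_sum]
    refine Finset.sum_congr rfl fun d _ => ?_
    rw [hL q (by omega), map_sum]
  -- every term except `(β₀, (0, q))` lies in `𝔪`
  have hterm : ∀ d ∈ P.support, ∀ ab ∈ Finset.HasAntidiagonal.antidiagonal q, (d, ab) ≠ (β₀, ((0 : ι →₀ ℕ), q)) →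
      Δ e (Δ ab.1 (P.coeff d) * Δ ab.2 (∏ j, u j ^ d j)) ∈ maximalIdeal R := by
    rintro d hd ⟨a, b⟩ hab hne
    have hab' : a + b = q := Finset.HasAntidiagonal.mem_antidiagonal.mp hab
    by_cases ha : a = 0
    · -- `a = 0`, `b = q`, `d ≠ β₀`
      subst ha
      rw [zero_add] at hab'
      subst hab'
      have hdne : d ≠ β₀ := fun h => hne (by rw [h])
      dsimp only
      by_cases hqd : q ≤ d
      · -- `d = q + r`, `|r| = 1`, `r i = 0`
        obtain ⟨r, hr⟩ : ∃ r, d = q + r := ⟨d - q, (add_tsub_cancel_of_le hqd).symm⟩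
        have hrdeg : r.degree = 1 := by
          have := congrArg Finsupp.degree hr
          rw [map_add, hdeg d hd, hqdeg] at this
          omega
        have hri : r i = 0 := by
          by_contra hri
          apply hdne
          have her : e ≤ r := by
            rw [he, Finsupp.single_le_iff]
            exact Nat.one_le_iff_ne_zero.mpr hri
          exact (eq_of_le_of_degree_eq' (show β₀ ≤ d by rw [hr, ← hqe]; exact add_le_add le_rfl her)
            (by rw [hβdeg, hdeg d hd])).symm
        have hdq : d - q = r := by rw [hr, add_tsub_cancel_left]
        have hx : (∏ j, u j ^ r j) ∈ maximalIdeal R := by simpa [hrdeg] using hmon r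
        have hex : Δ e (∏ j, u j ^ r j) = 0 := by
          rw [hV e r (by omega), he, Finsupp.support_single i one_ne_zero, Finset.prod_singleton,
            Finsupp.single_eq_same, Nat.choose_one_right, hri, Nat.cast_zero, zero_mul]
        rw [h0, hV q d (by omega), hdq, ← mul_assoc]
        have := sub_mem_of_isDiffOpLE_one hΔe (P.coeff d * ((∏ j ∈ q.support, (d j).choose (q j) : ℕ) : R)) hx
        rwa [hex, mul_zero, sub_zero] at this
      · -- `q ≰ d`: a binomial coefficient vanishes
        obtain ⟨j, hj⟩ : ∃ j, d j < q j := by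
          by_contra hcon
          push Not at hcon
          exact hqd (Finsupp.le_def.mpr hcon)
        have hjq : j ∈ q.support := Finsupp.mem_support_iff.mpr (by omega)
        have hV0 : Δ q (∏ l, u l ^ d l) = 0 := by
          rw [hV q d (by omega), Finset.prod_eq_zero hjq (Nat.choose_eq_zero_of_lt hj), Nat.cast_zero, zero_mul]
        rw [h0, hV0, mul_zero, map_zero]
        exact zero_mem _
    · -- `a ≠ 0`: `|b| ≤ N − 1`, so `Δ_b (u^d) ∈ 𝔪²`
      have hadeg : 1 ≤ a.degree :=
        Nat.one_le_iff_ne_zero.mpr fun h => ha ((Finsupp.degree_eq_zero_iff a).mp h)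
      have hbdeg : a.degree + b.degree = N := by
        have := congrArg Finsupp.degree hab'
        rw [map_add, hqdeg] at this
        exact this
      have hmb : Δ b (∏ j, u j ^ d j) ∈ maximalIdeal R ^ 2 := by
        have h := (hD b.degree b le_rfl (by omega)).apply_mem_pow_sub (maximalIdeal R) (N + 1) (hdeg d hd ▸ hmon d)
        exact Ideal.pow_le_pow_right (by omega) h
      have hprod : Δ a (P.coeff d) * Δ b (∏ j, u j ^ d j) ∈ maximalIdeal R ^ 2 := Ideal.mul_mem_left _ _ hmb
      have := hΔe.apply_mem_pow_sub (maximalIdeal R) 2 hprod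
      rwa [show 2 - 1 = 1 from rfl, pow_one] at this
  -- the term `(β₀, (0, q))` is `≡ c_{β₀} · C (mod 𝔪)` with `C = ∏ (β₀ over q)` a unit
  set C : R := ((∏ j ∈ q.support, (β₀ j).choose (q j) : ℕ) : R) with hC
  have hCu : IsUnit C := by
    rw [hC, Nat.cast_prod]
    refine IsUnit.prod_iff.mpr fun j _ => ?_
    by_cases hji : j = i
    · subst hji
      rw [hβi, Nat.choose_succ_self_right]
      exact hunit _ (hβi ▸ hi)
    · rw [hβj j hji, Nat.choose_self, Nat.cast_one]
      exact isUnit_one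
  have hue : (∏ j, u j ^ e j) ∈ maximalIdeal R := by simpa [hedeg] using hmon e
  have hee : Δ e (∏ j, u j ^ e j) = 1 := by
    rw [hV e e (by omega), tsub_self, he, Finsupp.support_single i one_ne_zero, Finset.prod_singleton,
      Finsupp.single_eq_same, Nat.choose_self, Nat.cast_one, one_mul]
    simp
  have hmain : Δ e (Δ (0 : ι →₀ ℕ) (P.coeff β₀) * Δ q (∏ j, u j ^ β₀ j)) - P.coeff β₀ * C ∈ maximalIdeal R := by
    rw [h0, hV q β₀ (by omega), hβq, ← mul_assoc]
    have := sub_mem_of_isDiffOpLE_one hΔe (P.coeff β₀ * C) hue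
    rwa [hee, mul_one] at this
  -- sum up modulo `𝔪`
  have hsum : Δ e (Δ q f) - (Δ e (Δ (0 : ι →₀ ℕ) (P.coeff β₀) * Δ q (∏ j, u j ^ β₀ j))) ∈ maximalIdeal R := by
    rw [hexp, ← Finset.add_sum_erase _ _ hβ₀, ← Finset.add_sum_erase _ _
      (show ((0 : ι →₀ ℕ), q) ∈ Finset.HasAntidiagonal.antidiagonal q from Finset.HasAntidiagonal.mem_antidiagonal.mpr (zero_add q))]
    have hA : ∑ ab ∈ (Finset.HasAntidiagonal.antidiagonal q).erase (0, q),
        Δ e (Δ ab.1 (P.coeff β₀) * Δ ab.2 (∏ j, u j ^ β₀ j)) ∈ maximalIdeal R :=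
      Ideal.sum_mem _ fun ab hab =>
        hterm β₀ hβ₀ ab (Finset.mem_of_mem_erase hab) fun h => (Finset.ne_of_mem_erase hab) (Prod.ext_iff.mp h).2
    have hB : ∑ d ∈ P.support.erase β₀, ∑ ab ∈ Finset.HasAntidiagonal.antidiagonal q,
        Δ e (Δ ab.1 (P.coeff d) * Δ ab.2 (∏ j, u j ^ d j)) ∈ maximalIdeal R :=
      Ideal.sum_mem _ fun d hd => Ideal.sum_mem _ fun ab hab =>
        hterm d (Finset.mem_of_mem_erase hd) ab hab fun h => (Finset.ne_of_mem_erase hd) (Prod.ext_iff.mp h).1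
    have : Δ e (Δ (0 : ι →₀ ℕ) (P.coeff β₀) * Δ q (∏ j, u j ^ β₀ j)) +
        ∑ ab ∈ (Finset.HasAntidiagonal.antidiagonal q).erase (0, q), Δ e (Δ ab.1 (P.coeff β₀) * Δ ab.2 (∏ j, u j ^ β₀ j)) +
        ∑ d ∈ P.support.erase β₀, ∑ ab ∈ Finset.HasAntidiagonal.antidiagonal q,
          Δ e (Δ ab.1 (P.coeff d) * Δ ab.2 (∏ j, u j ^ d j)) -
        Δ e (Δ (0 : ι →₀ ℕ) (P.coeff β₀) * Δ q (∏ j, u j ^ β₀ j)) =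
        ∑ ab ∈ (Finset.HasAntidiagonal.antidiagonal q).erase (0, q), Δ e (Δ ab.1 (P.coeff β₀) * Δ ab.2 (∏ j, u j ^ β₀ j)) +
        ∑ d ∈ P.support.erase β₀, ∑ ab ∈ Finset.HasAntidiagonal.antidiagonal q,
          Δ e (Δ ab.1 (P.coeff d) * Δ ab.2 (∏ j, u j ^ d j)) := by ring
    rw [this]
    exact add_mem hA hB
  -- conclusion: `c_{β₀} · C ∈ 𝔪`, absurd
  have hcC : P.coeff β₀ * C ∈ maximalIdeal R := by
    have := sub_mem (sub_mem hy hsum) hmain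
    rwa [sub_sub_cancel, sub_sub_cancel] at this
  rcases (Ideal.IsMaximal.isPrime' (maximalIdeal R)).mem_or_mem hcC with h | h
  · exact hc h
  · exact (maximalIdeal.isMaximal R).ne_top (Ideal.eq_top_of_isUnit_mem _ h hCu)

/-- **THE TAME CASE (KERNEL, PROVED)** (g23's original form): `p ∤ N + 1`, `f ∈ 𝔪^{N+1} ∖ 𝔪^{N+2}` ⇒
some `Δ_q f ∈ 𝔪 ∖ 𝔪²`,
`|q| = N` (a unit coefficient of the initial form has an exponent `≢ 0 (mod p)`, else `p ∣ Σ β_j = N + 1`).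
(Sources: EGAIV4, Thm. 16.11.2; Giraud1975; EncinasVillamayor2000, Thm. 4.9.) -/
theorem exists_hasse_apply_mem_and_notMem_sq {u : ι → R} (hu : Ideal.span (Set.range u) = maximalIdeal R) {N : ℕ}
    {Δ : (ι →₀ ℕ) → (R →ₗ[k] R)} (h0 : ∀ b, Δ 0 b = b)
    (hL : ∀ q : ι →₀ ℕ, q.degree ≤ N + 1 →
      ∀ f g : R, Δ q (f * g) = ∑ c ∈ Finset.HasAntidiagonal.antidiagonal q, Δ c.1 f * Δ c.2 g)
    (hV : ∀ q β : ι →₀ ℕ, q.degree ≤ N + 1 →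
      Δ q (∏ i, u i ^ β i) = ((∏ i ∈ q.support, (β i).choose (q i) : ℕ) : R) * ∏ i, u i ^ (β - q) i)
    (hD : ∀ (d : ℕ) (q : ι →₀ ℕ), q.degree ≤ d → d ≤ N + 1 → IsDiffOpLE k d (Δ q))
    {p : ℕ} (hunit : ∀ m : ℕ, ¬ p ∣ m → IsUnit ((m : ℕ) : R)) (hpN : ¬ p ∣ N + 1) {f : R}
    (h1 : f ∈ maximalIdeal R ^ (N + 1)) (h2 : f ∉ maximalIdeal R ^ (N + 2)) :
    ∃ q : ι →₀ ℕ, q.degree = N ∧ Δ q f ∈ maximalIdeal R ∧ Δ q f ∉ maximalIdeal R ^ 2 := by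
  classical
  have hum : ∀ i, u i ∈ maximalIdeal R := fun i => hu ▸ Ideal.subset_span ⟨i, rfl⟩
  have hmon : ∀ β : ι →₀ ℕ, (∏ i, u i ^ β i) ∈ maximalIdeal R ^ β.degree := fun β => prod_pow_mem_pow_degree hum β
  have h1' : f ∈ Ideal.span (Set.range u) ^ (N + 1) := by rw [hu]; exact h1
  obtain ⟨P, hP, hPf⟩ := (Ideal.mem_span_pow_iff_exists_isHomogeneous u f).mp h1'
  have hdeg : ∀ d ∈ P.support, Finsupp.degree d = N + 1 := fun d hd => by
    rw [Finsupp.degree_eq_weight_one]; exact hP (MvPolynomial.mem_support_iff.mp hd)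
  have hf : f = ∑ d ∈ P.support, P.coeff d * ∏ i, u i ^ d i := by rw [← hPf, MvPolynomial.eval_eq']
  obtain ⟨β₀, hβ₀, hc⟩ : ∃ β₀ ∈ P.support, P.coeff β₀ ∉ maximalIdeal R := by
    by_contra hcon
    push Not at hcon
    apply h2
    rw [hf]
    refine Ideal.sum_mem _ fun d hd => ?_
    have : P.coeff d * ∏ i, u i ^ d i ∈ maximalIdeal R * maximalIdeal R ^ (N + 1) :=
      Ideal.mul_mem_mul (hcon d hd) (hdeg d hd ▸ hmon d)
    rwa [← pow_succ'] at this
  obtain ⟨i, hi⟩ : ∃ i, ¬ p ∣ β₀ i := by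
    by_contra hcon
    push Not at hcon
    apply hpN
    rw [← hdeg β₀ hβ₀, Finsupp.degree_eq_sum]
    exact Finset.dvd_sum fun i _ => hcon i
  exact exists_hasse_apply_of_coeff hu h0 hL hV hD hunit P hP hPf hβ₀ hc hi

/-- **THE `p`-POWER CASE (KERNEL, PROVED · NEW in g23)**: `f ∈ 𝔪^{N+1}` NOT a `p`-power form modulo `𝔪^{N+2}`
(`f ∉ ⟨h^p : h ∈ 𝔪^{(N+1)/p}⟩ + 𝔪^{N+2}`) ⇒ some `Δ_q f ∈ 𝔪 ∖ 𝔪²`, `|q| = N` — for if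
every unit-coefficient monomial
of the initial form were a `p`-th power the form would lie in the `p`-power span (`mem_pPowerSpan_of_coeff`).
(Sources: EGAIV4, Thm. 16.11.2; Giraud1975; CossartPiltant2008, Prop. 4.2.) -/
theorem exists_hasse_apply_of_not_mem_pPowerSpan {u : ι → R} (hu : Ideal.span (Set.range u) = maximalIdeal R) {N : ℕ}
    {Δ : (ι →₀ ℕ) → (R →ₗ[k] R)} (h0 : ∀ b, Δ 0 b = b)
    (hL : ∀ q : ι →₀ ℕ, q.degree ≤ N + 1 →
      ∀ f g : R, Δ q (f * g) = ∑ c ∈ Finset.HasAntidiagonal.antidiagonal q, Δ c.1 f * Δ c.2 g)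
    (hV : ∀ q β : ι →₀ ℕ, q.degree ≤ N + 1 →
      Δ q (∏ i, u i ^ β i) = ((∏ i ∈ q.support, (β i).choose (q i) : ℕ) : R) * ∏ i, u i ^ (β - q) i)
    (hD : ∀ (d : ℕ) (q : ι →₀ ℕ), q.degree ≤ d → d ≤ N + 1 → IsDiffOpLE k d (Δ q))
    {p : ℕ} (hp : p.Prime) (hunit : ∀ m : ℕ, ¬ p ∣ m → IsUnit ((m : ℕ) : R)) {f : R}
    (h1 : f ∈ maximalIdeal R ^ (N + 1))
    (h2 : f ∉ Ideal.span ((fun h : R => h ^ p) '' ↑(maximalIdeal R ^ ((N + 1) / p))) ⊔ maximalIdeal R ^ (N + 2)) :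
    ∃ q : ι →₀ ℕ, q.degree = N ∧ Δ q f ∈ maximalIdeal R ∧ Δ q f ∉ maximalIdeal R ^ 2 := by
  classical
  have hum : ∀ i, u i ∈ maximalIdeal R := fun i => hu ▸ Ideal.subset_span ⟨i, rfl⟩
  have h1' : f ∈ Ideal.span (Set.range u) ^ (N + 1) := by rw [hu]; exact h1
  obtain ⟨P, hP, hPf⟩ := (Ideal.mem_span_pow_iff_exists_isHomogeneous u f).mp h1'
  obtain ⟨β₀, hβ₀, hc, i, hi⟩ : ∃ β₀ ∈ P.support, P.coeff β₀ ∉ maximalIdeal R ∧ ∃ i, ¬ p ∣ β₀ i := by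
    by_contra hcon
    push Not at hcon
    apply h2
    rw [← hPf]
    exact mem_pPowerSpan_of_coeff hum hp P hP fun d hd => by
      by_cases h : P.coeff d ∈ maximalIdeal R
      · exact Or.inl h
      · exact Or.inr (hcon d hd h)
  exact exists_hasse_apply_of_coeff hu h0 hL hV hD hunit P hP hPf hβ₀ hc hi

end LucasBite

end Summit.ResolutionOfSingularities.ResolutionOfSingularities.Theorems.HugValuationCut
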